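import Summits.AtomisticToContinuum.Crystallization.Theorems.FrustratedLawDichotomyAtlasDoor

/-!
# FrustratedLawDichotomy · crux `AperiodicFrustratedLawGap` (stmt-AtomisticToContinuum-27623) — T3′/T4′: THE ATLAS DOOR WITH TRANSPORT
# (decomp-a2c, RESIDUAL lens-5 «finite/base range + asymptotic regime + bridge», generation 114; H-TOLERANCE (ii) line, node «ZONE-TRANSPORT»)

T3 (`…MarginLedger`) and T4 (`…AtlasDoor`, (228)) turn DETERMINISTIC row floors `e⋆ + m_i ≤ rootEnergy μ` on measurable row classes `K i` and ONE residual
inequality `ResidualCoreDeficit` into the crux, with ZERO transport.  This file is the same bookkeeping with a signed covariant transport `F − G` (tree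
`…SignedLedger`: kernels `Measure E3 → E3 → ℝ≥0∞`, `net F G μ` = net signed flow at the root, mean zero by `integral_net_eq_zero`) carried through: rows are
floored on the TRANSPORTED energy `rootEnergy μ + net F G μ`, the residual inequality is stated for the transported deficit `e⋆ − rootEnergy μ − net F G μ`,
and the ledger books `F`, `G` themselves.

* §1 `lawLedgerOfMarginTransport` ★ — an integrable margin function `m` with `c + m μ ≤ rootEnergy μ + net F G μ` a.s. and `0 < E_P[m]` is a `LawLedger P c`
  (good = everything, `γ = E_P[m]`, charge `q = E_P[m] − m`, transport `F`, `G`); `lt_integral_rootEnergy_of_marginTransport`.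
* §2 `marginOfRowsT c n K mK F G = marginOfRows c n K mK + 1_{(⋃ K i)ᶜ}·net F G` (booked `m_i` on the first-hit cells, the tautological `rootEnergy + net − c`
  off the rows); its floor, integrability and ★ mean `Σ_{i<n} m_i·P(rowCell K i) − ∫_{(⋃ K i)ᶜ} (c − rootEnergy − net F G) dP`; `lawLedgerOfRowsTransport` ★★ —
  rows + a.s. transported floors + ONE transported residual inequality ⟹ `LawLedger P c`; `lt_integral_rootEnergy_of_rowsTransport`.
* §3 `lintegral_outflow_ne_top_of_bdd` — a kernel whose out-flow is bounded by a finite constant at every rooted `δ`-hard-core configuration has finite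
  mean out-flow under a probability law almost surely so carried (the finiteness clause of `LawLedger` for bounded-range kernels).
* §4 `ResidualCoreDeficitT n K mK F G` — `ResidualCoreDeficit` with the transported integrand (the crux's binder list at `δ = 7/10`, conclusion replaced) —
  and ★★ `aperiodicFrustratedLawGap_of_atlasTransport`: jointly measurable kernels with out-flows bounded at every rooted `7/10`-hard-core configuration,
  a finite row atlas with deterministic transported floors at every rooted `7/10`-hard-core Nash configuration of each row, plus `ResidualCoreDeficitT`,
  prove `AperiodicFrustratedLawGap` (route decl, by name).  With `F = G = 0` this is (228) (`net_zero`).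

Use (H-TOLERANCE (ii), lens-5 g114 memo HTOL-ii-g114): the zone rows book a host root whose near half-space is template-coherent at its NEAR-HALF energy
and let it PULL the attractive cross-plane half-bonds `½(−V_LJ)⁺` from unbooked (residual) far atoms within the halo radius (`G` = pull kernel, range 6,
bounded by hard-core counting); booked host roots are never pulled from; the residual inequality carries the inflow — the interface energy between
certified host and uncertified matter is booked on the uncertified side (critic r1747 (C) logic).
DEFS `lawLedgerOfMarginTransport marginOfRowsT lawLedgerOfRowsTransport ResidualCoreDeficitT` (plain `def`s; no instance / notation); imports TREE T4
`…AtlasDoor` (hence T3 `…MarginLedger`, `…HardCoreUpgrade`); 0 sorry.  Tags: [new: bookkeeping / junction].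
-/

noncomputable section

namespace Summit.AtomisticToContinuum.Crystallization.Theorems.FrustratedLawDichotomyAtlasDoorTransport

open MeasureTheory Set Filter
open scoped ENNReal BigOperators
open Literature.MathematicalPhysics.StatisticalMechanics Literature.Probability.Process
open Summit.AtomisticToContinuum.Crystallization.Theorems.ChargedEnergyGapNegative (E3)
open Summit.AtomisticToContinuum.Crystallization.Theorems.FrustratedLawDichotomySignedLedger (LawLedger net integral_net_eq_zero
  aperiodicFrustratedLawGap_of_lawLedger)
open Summit.AtomisticToContinuum.Crystallization.Theorems.FrustratedLawDichotomyHardCoreUpgrade (ae_isRootedHardCore_upgrade)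
open Summit.AtomisticToContinuum.Crystallization.Theorems.FrustratedLawDichotomyFiniteClusterGap (integrable_rootEnergy_of_ae_hardCore)
open Summit.AtomisticToContinuum.Crystallization.Theorems.FrustratedLawDichotomyMarginLedger (net_zero rowCell rowCell_subset measurableSet_rowCell
  marginOfRows marginOfRows_of_mem marginOfRows_of_not_mem exists_mem_rowCell integrable_marginOfRows integral_marginOfRows)

variable {δ : ℝ} {P : Measure (Measure E3)} {F G : Measure E3 → E3 → ℝ≥0∞}

/-! ## §1. A margin function floored on the transported energy is a ledger -/

/-- ★ **LEDGER FROM A MARGIN FUNCTION, TRANSPORTED FORM.**  An integrable `m` with `c + m μ ≤ rootEnergy V_LJ μ + net F G μ` almost surely and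
`0 < E_P[m]` gives a ledger at level `c` booking the transport `F − G`: every root good, credit `γ = E_P[m]`, charge `q = E_P[m] − m`.
[new: bookkeeping] -/
def lawLedgerOfMarginTransport [IsProbabilityMeasure P] {c : ℝ} (hF : Measurable (Function.uncurry F)) (hG : Measurable (Function.uncurry G))
    (houtF : ∫⁻ μ, ∫⁻ y, F μ y ∂μ ∂P ≠ ∞) (houtG : ∫⁻ μ, ∫⁻ y, G μ y ∂μ ∂P ≠ ∞) (m : Measure E3 → ℝ) (hm : Integrable m P)
    (hfloor : ∀ᵐ μ ∂P, c + m μ ≤ rootEnergy lennardJones μ + net F G μ) (hpos : 0 < ∫ μ, m μ ∂P) : LawLedger P c where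
  F := F
  G := G
  measF := hF
  measG := hG
  outF_ne_top := houtF
  outG_ne_top := houtG
  good := Set.univ
  good_meas := MeasurableSet.univ
  γ := ∫ μ, m μ ∂P
  σ := 0
  q := fun μ => (∫ μ, m μ ∂P) - m μ
  r := fun _ => 0
  q_int := (integrable_const _).sub hm
  r_int := integrable_const 0
  floor_good := by
    filter_upwards [hfloor] with μ hμ _
    linarith
  floor_bad := ae_of_all _ fun μ hμ => absurd (Set.mem_univ μ) hμ
  coercive := by
    have h1 : ∫ μ in Set.univ, ((∫ μ, m μ ∂P) - m μ) ∂P = (∫ μ, m μ ∂P) - ∫ μ, m μ ∂P := by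
      rw [Measure.restrict_univ, integral_sub (integrable_const _) hm, integral_const, smul_eq_mul, probReal_univ, one_mul]
    rw [h1, integral_zero, probReal_univ]
    linarith

/-- Corollary: a margin function with positive mean, floored on the transported energy, prices the mean root energy strictly above `c` for a
point-stationary hard-core law. [new: bookkeeping] -/
theorem lt_integral_rootEnergy_of_marginTransport [IsProbabilityMeasure P] {c : ℝ} (hδ : 0 < δ) (hcore : ∀ᵐ μ ∂P, IsRootedHardCore δ μ)
    (hstat : IsPointStationaryLaw P) (hF : Measurable (Function.uncurry F)) (hG : Measurable (Function.uncurry G))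
    (houtF : ∫⁻ μ, ∫⁻ y, F μ y ∂μ ∂P ≠ ∞) (houtG : ∫⁻ μ, ∫⁻ y, G μ y ∂μ ∂P ≠ ∞) (m : Measure E3 → ℝ) (hm : Integrable m P)
    (hfloor : ∀ᵐ μ ∂P, c + m μ ≤ rootEnergy lennardJones μ + net F G μ) (hpos : 0 < ∫ μ, m μ ∂P) :
    c < ∫ μ, rootEnergy lennardJones μ ∂P :=
  (lawLedgerOfMarginTransport hF hG houtF houtG m hm hfloor hpos).lt_integral_rootEnergy hδ hcore hstat

/-! ## §2. Finite row atlases floored on the transported energy -/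

/-- THE TRANSPORTED MARGIN OF A ROW ATLAS: the booked margin `m_i` on the first-hit cell of row `i < n`, the tautological `rootEnergy + net F G − c`
off the rows; written as the zero-transport atlas margin plus the net flow off the rows. [new: bookkeeping] -/
def marginOfRowsT (c : ℝ) (n : ℕ) (K : ℕ → Set (Measure E3)) (mK : ℕ → ℝ) (F G : Measure E3 → E3 → ℝ≥0∞) (μ : Measure E3) : ℝ :=
  marginOfRows c n K mK μ + (⋃ i ∈ Finset.range n, K i)ᶜ.indicator (fun μ => net F G μ) μ

/-- On the first-hit cell of row `i < n` the transported atlas margin is `m_i`. [new: bookkeeping] -/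
theorem marginOfRowsT_of_mem {c : ℝ} {n : ℕ} {K : ℕ → Set (Measure E3)} {mK : ℕ → ℝ} {μ : Measure E3} {i : ℕ} (hi : i ∈ Finset.range n)
    (hμ : μ ∈ rowCell K i) : marginOfRowsT c n K mK F G μ = mK i := by
  unfold marginOfRowsT
  have hcov : μ ∈ ⋃ j ∈ Finset.range n, K j := Set.mem_biUnion hi (rowCell_subset K i hμ)
  rw [marginOfRows_of_mem hi hμ, Set.indicator_of_notMem (Set.notMem_compl_iff.2 hcov), add_zero]

/-- Off the rows the transported atlas margin is the tautological one. [new: bookkeeping] -/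
theorem marginOfRowsT_of_not_mem {c : ℝ} {n : ℕ} {K : ℕ → Set (Measure E3)} {mK : ℕ → ℝ} {μ : Measure E3}
    (hμ : μ ∉ ⋃ i ∈ Finset.range n, K i) : marginOfRowsT c n K mK F G μ = rootEnergy lennardJones μ + net F G μ - c := by
  unfold marginOfRowsT
  rw [marginOfRows_of_not_mem hμ, Set.indicator_of_mem (Set.mem_compl hμ)]
  ring

/-- The transported atlas margin is a pointwise floor on the transported energy almost surely, given the row floors. [new: bookkeeping] -/
theorem floor_marginOfRowsT {c : ℝ} {n : ℕ} {K : ℕ → Set (Measure E3)} {mK : ℕ → ℝ}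
    (hfloor : ∀ i < n, ∀ᵐ μ ∂P, μ ∈ K i → c + mK i ≤ rootEnergy lennardJones μ + net F G μ) :
    ∀ᵐ μ ∂P, c + marginOfRowsT c n K mK F G μ ≤ rootEnergy lennardJones μ + net F G μ := by
  have hall : ∀ᵐ μ ∂P, ∀ i, i < n → μ ∈ K i → c + mK i ≤ rootEnergy lennardJones μ + net F G μ := by
    refine ae_all_iff.2 fun i => ?_
    by_cases hi : i < n
    · filter_upwards [hfloor i hi] with μ h using fun _ => h
    · exact ae_of_all _ fun μ hi' => absurd hi' hi
  filter_upwards [hall] with μ hμ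
  by_cases hcov : μ ∈ ⋃ i ∈ Finset.range n, K i
  · obtain ⟨i, hi, hμi⟩ := exists_mem_rowCell hcov
    rw [marginOfRowsT_of_mem hi hμi]
    exact hμ i (Finset.mem_range.1 hi) (rowCell_subset K i hμi)
  · rw [marginOfRowsT_of_not_mem hcov]
    linarith

/-- The transported atlas margin is integrable (hard core ⇒ `rootEnergy` integrable; signed mass transport ⇒ `net F G` integrable). [new: bookkeeping] -/
theorem integrable_marginOfRowsT [IsProbabilityMeasure P] {c : ℝ} {n : ℕ} {K : ℕ → Set (Measure E3)} (hK : ∀ i, MeasurableSet (K i)) {mK : ℕ → ℝ}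
    (hδ : 0 < δ) (hcore : ∀ᵐ μ ∂P, IsRootedHardCore δ μ) (hstat : IsPointStationaryLaw P) (hF : Measurable (Function.uncurry F))
    (hG : Measurable (Function.uncurry G)) (houtF : ∫⁻ μ, ∫⁻ y, F μ y ∂μ ∂P ≠ ∞) (houtG : ∫⁻ μ, ∫⁻ y, G μ y ∂μ ∂P ≠ ∞) :
    Integrable (marginOfRowsT c n K mK F G) P :=
  (integrable_marginOfRows hK hδ hcore).add
    ((integral_net_eq_zero hδ hcore hstat hF hG houtF houtG).1.indicator (Finset.measurableSet_biUnion _ fun j _ => hK j).compl)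

/-- ★ THE MEAN OF THE TRANSPORTED ATLAS MARGIN = booked credit of the first-hit cells − mean transported deficit of the uncovered roots.
[new: bookkeeping] -/
theorem integral_marginOfRowsT [IsProbabilityMeasure P] {c : ℝ} {n : ℕ} {K : ℕ → Set (Measure E3)} (hK : ∀ i, MeasurableSet (K i)) {mK : ℕ → ℝ}
    (hδ : 0 < δ) (hcore : ∀ᵐ μ ∂P, IsRootedHardCore δ μ) (hstat : IsPointStationaryLaw P) (hF : Measurable (Function.uncurry F))
    (hG : Measurable (Function.uncurry G)) (houtF : ∫⁻ μ, ∫⁻ y, F μ y ∂μ ∂P ≠ ∞) (houtG : ∫⁻ μ, ∫⁻ y, G μ y ∂μ ∂P ≠ ∞) :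
    ∫ μ, marginOfRowsT c n K mK F G μ ∂P =
      ∑ i ∈ Finset.range n, mK i * P.real (rowCell K i) -
        ∫ μ in (⋃ i ∈ Finset.range n, K i)ᶜ, (c - rootEnergy lennardJones μ - net F G μ) ∂P := by
  have hU : MeasurableSet (⋃ i ∈ Finset.range n, K i) := Finset.measurableSet_biUnion _ fun j _ => hK j
  have hIn : Integrable (fun μ => net F G μ) P := (integral_net_eq_zero hδ hcore hstat hF hG houtF houtG).1
  have hIe : Integrable (fun μ => rootEnergy lennardJones μ) P := integrable_rootEnergy_of_ae_hardCore hδ hcore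
  have h1 : ∫ μ, marginOfRowsT c n K mK F G μ ∂P =
      ∫ μ, marginOfRows c n K mK μ ∂P + ∫ μ, (⋃ i ∈ Finset.range n, K i)ᶜ.indicator (fun μ => net F G μ) μ ∂P :=
    integral_add (integrable_marginOfRows hK hδ hcore) (hIn.indicator hU.compl)
  have h2 : ∫ μ in (⋃ i ∈ Finset.range n, K i)ᶜ, (c - rootEnergy lennardJones μ - net F G μ) ∂P =
      ∫ μ in (⋃ i ∈ Finset.range n, K i)ᶜ, (c - rootEnergy lennardJones μ) ∂P - ∫ μ in (⋃ i ∈ Finset.range n, K i)ᶜ, net F G μ ∂P :=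
    integral_sub ((integrable_const c).sub hIe).restrict hIn.restrict
  rw [h1, integral_marginOfRows hK hδ hcore, integral_indicator hU.compl, h2]
  ring

/-- ★★ **LEDGER FROM A FINITE ROW ATLAS FLOORED ON THE TRANSPORTED ENERGY + ONE RESIDUAL INEQUALITY.**  Kernels `F`, `G` (jointly measurable, finite
mean out-flow), rows `K i` (`i < n`, measurable, possibly overlapping) with booked margins `m_i` of any sign and almost-sure floors
`c + m_i ≤ rootEnergy V_LJ μ + net F G μ` on `K i`; if the MEAN TRANSPORTED DEFICIT of the uncovered roots is below the booked credit of the first-hit cells,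
`∫_{(⋃_{i<n} K i)ᶜ} (c − rootEnergy μ − net F G μ) dP < Σ_{i<n} m_i·P(rowCell K i)`, then there is a ledger at level `c` booking `F − G`. [new: bookkeeping] -/
def lawLedgerOfRowsTransport [IsProbabilityMeasure P] {c : ℝ} (hδ : 0 < δ) (hcore : ∀ᵐ μ ∂P, IsRootedHardCore δ μ) (hstat : IsPointStationaryLaw P)
    (hF : Measurable (Function.uncurry F)) (hG : Measurable (Function.uncurry G)) (houtF : ∫⁻ μ, ∫⁻ y, F μ y ∂μ ∂P ≠ ∞)
    (houtG : ∫⁻ μ, ∫⁻ y, G μ y ∂μ ∂P ≠ ∞) (n : ℕ) (K : ℕ → Set (Measure E3)) (hK : ∀ i, MeasurableSet (K i)) (mK : ℕ → ℝ)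
    (hfloor : ∀ i < n, ∀ᵐ μ ∂P, μ ∈ K i → c + mK i ≤ rootEnergy lennardJones μ + net F G μ)
    (hres : ∫ μ in (⋃ i ∈ Finset.range n, K i)ᶜ, (c - rootEnergy lennardJones μ - net F G μ) ∂P < ∑ i ∈ Finset.range n, mK i * P.real (rowCell K i)) :
    LawLedger P c :=
  lawLedgerOfMarginTransport hF hG houtF houtG (marginOfRowsT c n K mK F G) (integrable_marginOfRowsT hK hδ hcore hstat hF hG houtF houtG)
    (floor_marginOfRowsT hfloor) (by rw [integral_marginOfRowsT hK hδ hcore hstat hF hG houtF houtG]; linarith)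

/-- Corollary: a finite row atlas floored on the transported energy, with the transported residual inequality, prices the mean root energy of a
point-stationary hard-core law strictly above `c`. [new: bookkeeping] -/
theorem lt_integral_rootEnergy_of_rowsTransport [IsProbabilityMeasure P] {c : ℝ} (hδ : 0 < δ) (hcore : ∀ᵐ μ ∂P, IsRootedHardCore δ μ)
    (hstat : IsPointStationaryLaw P) (hF : Measurable (Function.uncurry F)) (hG : Measurable (Function.uncurry G))
    (houtF : ∫⁻ μ, ∫⁻ y, F μ y ∂μ ∂P ≠ ∞) (houtG : ∫⁻ μ, ∫⁻ y, G μ y ∂μ ∂P ≠ ∞) (n : ℕ) (K : ℕ → Set (Measure E3)) (hK : ∀ i, MeasurableSet (K i))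
    (mK : ℕ → ℝ) (hfloor : ∀ i < n, ∀ᵐ μ ∂P, μ ∈ K i → c + mK i ≤ rootEnergy lennardJones μ + net F G μ)
    (hres : ∫ μ in (⋃ i ∈ Finset.range n, K i)ᶜ, (c - rootEnergy lennardJones μ - net F G μ) ∂P < ∑ i ∈ Finset.range n, mK i * P.real (rowCell K i)) :
    c < ∫ μ, rootEnergy lennardJones μ ∂P :=
  (lawLedgerOfRowsTransport hδ hcore hstat hF hG houtF houtG n K hK mK hfloor hres).lt_integral_rootEnergy hδ hcore hstat

/-! ## §3. Bounded out-flow ⇒ finite mean out-flow -/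

/-- A kernel whose out-flow `∫⁻ y, F μ y ∂μ` is bounded by a finite constant at every rooted `δ`-hard-core configuration has finite mean out-flow under a
probability law almost surely carried by such configurations. [new: bookkeeping] -/
theorem lintegral_outflow_ne_top_of_bdd [IsProbabilityMeasure P] (hcore : ∀ᵐ μ ∂P, IsRootedHardCore δ μ) {B : ℝ≥0∞} (hB : B ≠ ∞)
    (hFb : ∀ μ : Measure E3, IsRootedHardCore δ μ → ∫⁻ y, F μ y ∂μ ≤ B) : ∫⁻ μ, ∫⁻ y, F μ y ∂μ ∂P ≠ ∞ := by
  refine ne_top_of_le_ne_top (by simpa using hB : B * P Set.univ ≠ ∞) ?_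
  calc ∫⁻ μ, ∫⁻ y, F μ y ∂μ ∂P ≤ ∫⁻ _μ, B ∂P := lintegral_mono_ae (by filter_upwards [hcore] with μ hμ using hFb μ hμ)
    _ = B * P Set.univ := lintegral_const B

/-! ## §4. The residual hypothesis with transport and the atlas door with transport (route decl, by name) -/

/-- ★ **THE TRANSPORTED RESIDUAL-CORE DEFICIT HYPOTHESIS of a row atlas** `(n, K, mK)` **with kernels** `F`, `G`: for every point-stationary probability
law `P` that is almost surely rooted `7/10`-hard-core, texture-charged (clause (d) verbatim), Nash at every atom (clause (e) verbatim), almost surely not a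
periodic translate and MINIMISING (`E_P[rootEnergy] ≤ e⋆`), the mean TRANSPORTED deficit of the uncovered roots is below the booked credit of the first-hit
cells: `∫_{(⋃_{i<n} K i)ᶜ} (e⋆ − rootEnergy μ − net F G μ) dP < Σ_{i<n} m_i·P(rowCell K i)`.  (`ResidualCoreDeficit` is the case `F = G = 0`.) [new: junction] -/
def ResidualCoreDeficitT (n : ℕ) (K : ℕ → Set (MeasureTheory.Measure (EuclideanSpace ℝ (Fin 3)))) (mK : ℕ → ℝ)
    (F G : MeasureTheory.Measure (EuclideanSpace ℝ (Fin 3)) → EuclideanSpace ℝ (Fin 3) → ℝ≥0∞) : Prop :=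
  ∀ P : MeasureTheory.Measure (MeasureTheory.Measure (EuclideanSpace ℝ (Fin 3))), let Gy : ℝ → (N : ℕ) → (Fin N → EuclideanSpace ℝ (Fin 3)) → Fin N → Prop := fun η N y j => let d : ℝ := sInf ((fun z => dist z (y (j : Fin N))) '' (Set.range (y) \ {(y (j : Fin N))})); let T : Set (EuclideanSpace ℝ (Fin 3)) := {z : EuclideanSpace ℝ (Fin 3) | z ∈ Set.range (y) ∧ z ≠ (y (j : Fin N)) ∧ dist z (y (j : Fin N)) < 13 / 10 * d}; ∃ A : EuclideanSpace ℝ (Fin 3) →ₗᵢ[ℝ] EuclideanSpace ℝ (Fin 3), (∃ e : ↥T ≃ ↥Literature.Geometry.DiscreteGeometry.fccKissingPattern, ∀ t : ↥T, dist (d⁻¹ • ((t : EuclideanSpace ℝ (Fin 3)) - (y (j : Fin N)))) (A ((e t : ↥Literature.Geometry.DiscreteGeometry.fccKissingPattern) : EuclideanSpace ℝ (Fin 3))) ≤ η) ∨ (∃ e : ↥T ≃ ↥Literature.Geometry.DiscreteGeometry.hcpKissingPattern, ∀ t : ↥T, dist (d⁻¹ • ((t : EuclideanSpace ℝ (Fin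 3)) - (y (j : Fin N)))) (A ((e t : ↥Literature.Geometry.DiscreteGeometry.hcpKissingPattern) : EuclideanSpace ℝ (Fin 3))) ≤ η); let TexBall : (N : ℕ) → (Fin N → EuclideanSpace ℝ (Fin 3)) → Fin N → ℝ → ℝ → ℝ → ℝ → Prop := fun N y i R R₇ R₈ R₉ => (∀ a b : Fin N, a ≠ b → (7 : ℝ) / 10 ≤ dist (y a) (y b)) ∧ (∀ j : Fin N, dist (y j) (y i) ≤ R → ¬ Gy (1 / 20) N (y) j) ∧ (∀ j : Fin N, dist (y j) (y i) ≤ R → ¬ ((∀ j' : Fin N, dist (y j') (y j) ≤ R₇ → ¬ Gy (1 / 20) N (y) j') ∧ (∀ z : EuclideanSpace ℝ (Fin 3), dist z (y j) ≤ R₇ → ∃ k : Fin N, dist z (y k) ≤ 1) ∧ (∀ j' : Fin N, dist (y j') (y j) ≤ R₇ → (let d : ℝ := sInf ((fun z => dist z (y j')) '' (Set.range (y) \ {(y j')})); ∀ k : Fin N, y k ≠ y j' → dist (y k) (y j') < 27 / 20 * d → 5 ≤ Nat.card {m : Fin N // y m ≠ y j' ∧ dist (y m) (y j') < 27 / 20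 * d ∧ y m ≠ y k ∧ dist (y m) (y k) < 27 / 20 * d})))) ∧ (∀ j : Fin N, dist (y j) (y i) ≤ R → ∃ k : Fin N, dist (y k) (y j) ≤ R₈ ∧ Gy (1 / 8) N (y) k) ∧ (∀ j : Fin N, dist (y j) (y i) ≤ R → ¬ ((∀ j' : Fin N, dist (y j') (y j) ≤ R₉ → ¬ Gy (1 / 20) N (y) j') ∧ (Nat.card {j' : Fin N // dist (y j') (y j) ≤ R₉ ∧ ¬ Gy (1 / 8) N (y) j'} : ℝ) ≤ 1 / 2 * (Nat.card {j' : Fin N // dist (y j') (y j) ≤ R₉} : ℝ) ∧ (∀ j' : Fin N, dist (y j') (y j) ≤ R₉ → ¬ Gy (1 / 8) N (y) j' → ¬ (let d : ℝ := sInf ((fun z => dist z (y j')) '' (Set.range (y) \ {(y j')})); ∀ k : Fin N, y k ≠ y j' → dist (y k) (y j') < 27 / 20 * d → 5 ≤ Nat.card {m : Fin N // y m ≠ y j' ∧ dist (y m) (y j') < 27 / 20 * d ∧ y m ≠ y k ∧ dist (y m) (y k) < 27 / 20 * d})))); let Appr : MeasureTheory.Measure (EuclideanSpace ℝ (Fin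 3)) → ℝ → ℝ → ℝ → Prop := fun μ R₇ R₈ R₉ => ∀ q : EuclideanSpace ℝ (Fin 3), μ {q} ≠ 0 → ∀ R ε : ℝ, 0 < ε → ∃ (N : ℕ) (y : Fin N → EuclideanSpace ℝ (Fin 3)) (i : Fin N), TexBall N y i R R₇ R₈ R₉ ∧ (∀ p : EuclideanSpace ℝ (Fin 3), μ {p} ≠ 0 → dist p q ≤ R → ∃ k : Fin N, dist (y k - y i) (p - q) ≤ ε) ∧ (∀ k : Fin N, dist (y k) (y i) ≤ R → ∃ p : EuclideanSpace ℝ (Fin 3), μ {p} ≠ 0 ∧ dist (y k - y i) (p - q) ≤ ε); MeasureTheory.IsProbabilityMeasure P → (∀ᵐ μ ∂P, Literature.Probability.Process.IsRootedHardCore (7 / 10) μ) → Literature.Probability.Process.IsPointStationaryLaw P → (∃ R₇ R₈ R₉ : ℝ, ∀ᵐ μ ∂P, Appr μ R₇ R₈ R₉) → (∀ᵐ μ ∂P, ∀ p : EuclideanSpace ℝ (Fin 3), μ {p} ≠ 0 → ∀ y : EuclideanSpace ℝ (Fin 3), (∀ q : EuclideanSpace ℝ (Fin 3), μ {q} ≠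 0 → q ≠ p → y ≠ q) → ∑' q : {q : EuclideanSpace ℝ (Fin 3) // μ {q} ≠ 0 ∧ q ≠ p}, Literature.MathematicalPhysics.StatisticalMechanics.lennardJones (dist p (q : EuclideanSpace ℝ (Fin 3))) ≤ ∑' q : {q : EuclideanSpace ℝ (Fin 3) // μ {q} ≠ 0 ∧ q ≠ p}, Literature.MathematicalPhysics.StatisticalMechanics.lennardJones (dist y (q : EuclideanSpace ℝ (Fin 3)))) → P {μ : MeasureTheory.Measure (EuclideanSpace ℝ (Fin 3)) | ∃ Q : Literature.MathematicalPhysics.StatisticalMechanics.PeriodicConfiguration 3, ∃ t : EuclideanSpace ℝ (Fin 3), {p : EuclideanSpace ℝ (Fin 3) | μ {p} ≠ 0} = (fun s => s + t) '' Q.points} = 0 → (∫ μ, Literature.MathematicalPhysics.StatisticalMechanics.rootEnergy Literature.MathematicalPhysics.StatisticalMechanics.lennardJones μ ∂P) ≤ (⨅ Q : Literature.MathematicalPhysics.StatisticalMechanics.PeriodicConfiguration 3, Q.energyPerParticle Literature.MathematicalPhysics.StatisticalMechanics.lennardJones) → (∫ μ in (⋃ i ∈ Finset.range n, K i)ᶜ,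 ((⨅ Q : Literature.MathematicalPhysics.StatisticalMechanics.PeriodicConfiguration 3, Q.energyPerParticle Literature.MathematicalPhysics.StatisticalMechanics.lennardJones) - Literature.MathematicalPhysics.StatisticalMechanics.rootEnergy Literature.MathematicalPhysics.StatisticalMechanics.lennardJones μ - net F G μ) ∂P) < ∑ i ∈ Finset.range n, mK i * P.real (rowCell K i)

/-- ★★ **THE ATLAS DOOR WITH TRANSPORT (route decl, by name).**  Jointly measurable kernels `F`, `G` whose out-flows are bounded by finite constants at
every rooted `7/10`-hard-core configuration, a finite row atlas with deterministic floors ON THE TRANSPORTED ENERGY `rootEnergy μ + net F G μ` at every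
rooted `7/10`-hard-core Nash configuration of each row, plus `ResidualCoreDeficitT` for it, prove `AperiodicFrustratedLawGap`. [new: junction] -/
theorem aperiodicFrustratedLawGap_of_atlasTransport (n : ℕ) (K : ℕ → Set (MeasureTheory.Measure (EuclideanSpace ℝ (Fin 3)))) (hK : ∀ i, MeasurableSet (K i)) (mK : ℕ → ℝ)
    (F G : MeasureTheory.Measure (EuclideanSpace ℝ (Fin 3)) → EuclideanSpace ℝ (Fin 3) → ℝ≥0∞)
    (hF : Measurable (Function.uncurry F)) (hG : Measurable (Function.uncurry G)) {BF BG : ℝ≥0∞} (hBF : BF ≠ ∞) (hBG : BG ≠ ∞)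
    (hFb : ∀ μ : MeasureTheory.Measure (EuclideanSpace ℝ (Fin 3)), Literature.Probability.Process.IsRootedHardCore (7 / 10) μ → ∫⁻ y, F μ y ∂μ ≤ BF)
    (hGb : ∀ μ : MeasureTheory.Measure (EuclideanSpace ℝ (Fin 3)), Literature.Probability.Process.IsRootedHardCore (7 / 10) μ → ∫⁻ y, G μ y ∂μ ≤ BG)
    (hfloor : ∀ i < n, ∀ μ : MeasureTheory.Measure (EuclideanSpace ℝ (Fin 3)), Literature.Probability.Process.IsRootedHardCore (7 / 10) μ →
      (∀ p : EuclideanSpace ℝ (Fin 3), μ {p} ≠ 0 → ∀ y : EuclideanSpace ℝ (Fin 3), (∀ q : EuclideanSpace ℝ (Fin 3), μ {q} ≠ 0 → q ≠ p → y ≠ q) → ∑' q : {q : EuclideanSpace ℝ (Fin 3) // μ {q} ≠ 0 ∧ q ≠ p}, Literature.MathematicalPhysics.StatisticalMechanics.lennardJones (dist p (q : EuclideanSpace ℝ (Fin 3))) ≤ ∑' q : {q : EuclideanSpace ℝ (Fin 3) // μ {q} ≠ 0 ∧ q ≠ p}, Literature.MathematicalPhysics.StatisticalMechanics.lennardJones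 (dist y (q : EuclideanSpace ℝ (Fin 3)))) → μ ∈ K i →
      (⨅ Q : Literature.MathematicalPhysics.StatisticalMechanics.PeriodicConfiguration 3, Q.energyPerParticle Literature.MathematicalPhysics.StatisticalMechanics.lennardJones) + mK i ≤ Literature.MathematicalPhysics.StatisticalMechanics.rootEnergy Literature.MathematicalPhysics.StatisticalMechanics.lennardJones μ + net F G μ)
    (hres : ResidualCoreDeficitT n K mK F G) :
    Summit.AtomisticToContinuum.Crystallization.Theses.FrustratedLawDichotomy.AperiodicFrustratedLawGap := by
  refine aperiodicFrustratedLawGap_of_lawLedger fun δ hδ P => ?_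
  have hres' := hres P
  dsimp only at hres' ⊢
  intro hP ha hb hd he h0 hmin
  have ha' : ∀ᵐ μ ∂P, Literature.Probability.Process.IsRootedHardCore (7 / 10) μ := by
    obtain ⟨R₇, R₈, R₉, hd'⟩ := hd
    refine ae_isRootedHardCore_upgrade ha ?_
    filter_upwards [hd'] with μ hμ q hq R ε hε
    obtain ⟨N, y, i, ⟨hsep, -⟩, hm, -⟩ := hμ q hq R ε hε
    exact ⟨N, y, i, hsep, hm⟩
  have hR := hres' hP ha' hb hd he h0 hmin
  have h7 : (0 : ℝ) < 7 / 10 := by norm_num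
  exact ⟨lawLedgerOfRowsTransport h7 ha' hb hF hG (lintegral_outflow_ne_top_of_bdd ha' hBF hFb) (lintegral_outflow_ne_top_of_bdd ha' hBG hGb) n K hK mK
    (fun i hi => by
      filter_upwards [ha', he] with μ hμ hN hμi
      exact hfloor i hi μ hμ hN hμi) hR⟩

/-- Sanity: with zero transport the transported residual hypothesis is (228)'s `ResidualCoreDeficit` verbatim (`net 0 0 = 0`). [new: bookkeeping] -/
theorem residualCoreDeficitT_zero_iff (n : ℕ) (K : ℕ → Set (MeasureTheory.Measure (EuclideanSpace ℝ (Fin 3)))) (mK : ℕ → ℝ) :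
    ResidualCoreDeficitT n K mK (fun _ _ => 0) (fun _ _ => 0) ↔
      Summit.AtomisticToContinuum.Crystallization.Theorems.FrustratedLawDichotomyAtlasDoor.ResidualCoreDeficit n K mK := by
  simp only [ResidualCoreDeficitT, Summit.AtomisticToContinuum.Crystallization.Theorems.FrustratedLawDichotomyAtlasDoor.ResidualCoreDeficit, net_zero,
    sub_zero]

end Summit.AtomisticToContinuum.Crystallization.Theorems.FrustratedLawDichotomyAtlasDoorTransport

end
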